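import Summits.MatrixMultiplication.MatrixMultiplication.Theorems.SaturationLadderLevelTwoK4Word
import Literature.Computability.AlgebraicComplexity.RectangularExponentAlpha
import HarnessLib

/-!
# Level 2 of the saturation ladder at `ω(1,4,1)`: `ω(1,4,1) ≤ 223/43 = 5.18605…`
# (route `SaturationLadder`, node `TailDescentTwo`, lens 1 «grading / quantitative ladder», gen 22)

Cell `decomp-mm`, lens 1, gen 22 — third rung of the level-2 DEFECT LADDER `δ_k = ω(1,k,1) − k`
in proved currency, same kernel as `SaturationLadderLevelTwoK2` (`δ₂ ≤ 101/31 − 3 = 0.2581`) and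
`SaturationLadderLevelTwoK3` (`δ₃ ≤ 80/19 − 4 = 0.2106`): **`ω(1,4,1) ≤ 223/43`**, i.e.
`δ₄ ≤ 8/43 = 0.18605` (`omegaRect_one_four_one_le_223_43`), beating descent from the `k = 3` rung
(`80/19 + 1 = 5.2106`), and the tail `ω(1,k,1) ≤ k + 51/43` for every real `k ≥ 4`
(`omegaRect_one_mid_one_le_add_of_four`).  No named facts, no sorry, no definitions (design and law
in `SaturationLadderLevelTwoK4Word`, shared lemmas in `SaturationLadderLevelTwoKit`).

THE PROOF.  `laserMethod_hasFormatValue_of_wordValue` on the valued word `lvl2Word` (`d = 2054`,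
`q = 6`, `102` copies of the `3 : 3 : 2` family block at `σ = 19/20`, NO letter `400`); the law is
of product form on the used support, its row `I = 4` is empty, so the penalty is `0` (zero-row
lemma); marginals `x : (1088, 640, 316, 10, 0)/2054`, `y = z : (79, 650, 1172, 149, 4)/2054`,
`H_y ≤ H_x` (`cert_marginals`); formats `A⁴ ≤ B` by `cert_format : 6^14586 ≤ 12^1940 · 38^5860`;
packing `2^{H_y} W A^{ω(1,4,1)} ≤ R̃(CW_6^{⊗2}) ≤ 64` and the final integer certificate
`cert_final : 2^409688 · 5^55900 · 149^6407 · 293^50396 ≤ 3^117967 · 13^60372 · 19^12488 · 79^84925`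
(prime logarithms `ln 2054 = ln 2 + ln 13 + ln 79`, `ln 650 = ln 2 + 2 ln 5 + ln 13`,
`ln 1172 = 2 ln 2 + ln 293`).  Numerics (gen22/design332.py, intsearch332.py, certs_k4.py): real
optimum of this kernel at `k = 4`: `5.18459` (`q = 6`; `q = 7`: `5.18141`), integer design
`5.1853136`, `ln B / ln A = 4.000203`, slack to `223/43`: `7.3e-4`, log-margin of `cert_final`: `36.7`.
PRINT: `ω(1,4,1) ≤ 5.172` (Le Gall–Urrutia 2018 / VXXZ 2024, higher levels).  All certificates are
`decide`d integer inequalities (kernel, no `native_decide`; `exponentiation.threshold 500000`).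

## References

* F. Le Gall, *Faster algorithms for rectangular matrix multiplication*, FOCS 2012,
  arXiv:1204.1111, §3, §6.1, Prop. 6.2, Table 2. [LeGall2012]
* D. Coppersmith, S. Winograd, *Matrix multiplication via arithmetic progressions*,
  J. Symbolic Comput. 9 (1990), §8. [CoppersmithWinograd1990]
* D. Coppersmith, *Rectangular matrix multiplication revisited*, J. Complexity 13 (1997), §3.
  [Coppersmith1997]
* F. Le Gall, *Powers of tensors and fast matrix multiplication*, ISSAC 2014, arXiv:1401.7714,
  Thm. 4.1 and Appendix A.3. [LeGall2014]
* F. Le Gall, F. Urrutia, *Improved rectangular matrix multiplication using powers of the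
  Coppersmith–Winograd tensor*, SODA 2018, arXiv:1708.05622, Table 3. [LeGallUrrutia2018]
* V. Vassilevska Williams, Y. Xu, Z. Xu, R. Zhou, *New bounds for matrix multiplication: from
  alpha to omega*, SODA 2024, Table 1. [VassilevskaWilliamsXuXuZhou2024]
-/

set_option linter.dupNamespace false
set_option autoImplicit false
set_option exponentiation.threshold 500000
set_option maxRecDepth 100000

noncomputable section

open Finset Real
open scoped BigOperators

namespace Summit.MatrixMultiplication.MatrixMultiplication.Theorems.SaturationLadderLevelTwoK4

open Literature.Computability.AlgebraicComplexity
open SaturationLadderLevelTwoKit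
open SaturationLadderLevelTwo (append_mem repWord_mem const_mem fin5_lits negMulLog_div'
  log_two_mul_shannonEntropy_fin5)

/-! ## Marginal entropies -/

/-- **`ln 2 · H_x = ln 2054 − (1088 ln 1088 + 640 ln 640 + 316 ln 316 + 10 ln 10)/2054`.** [folklore] -/
theorem entropy₁_lvl2Law : Real.log 2 * shannonEntropy (marginalDist₁ lvl2Law) =
    Real.log 2054 - (1088 * Real.log 1088 + 640 * Real.log 640 + 316 * Real.log 316 +
      10 * Real.log 10) / 2054 := by
  obtain ⟨e0, e1, e2, e3, e4⟩ := marginalDist₁_lvl2Law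
  rw [log_two_mul_shannonEntropy_fin5, e0, e1, e2, e3, e4,
    negMulLog_div' (by norm_num) (by norm_num), negMulLog_div' (by norm_num) (by norm_num),
    negMulLog_div' (by norm_num) (by norm_num), negMulLog_div' (by norm_num) (by norm_num),
    Real.negMulLog_zero]
  ring

/-- **`ln 2 · H_y = ln 2054 − (79 ln 79 + 650 ln 650 + 1172 ln 1172 + 149 ln 149 + 4 ln 4)/2054`.**
[folklore] -/
theorem entropy₂_lvl2Law : Real.log 2 * shannonEntropy (marginalDist₂ lvl2Law) =
    Real.log 2054 - (79 * Real.log 79 + 650 * Real.log 650 + 1172 * Real.log 1172 +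
      149 * Real.log 149 + 4 * Real.log 4) / 2054 := by
  obtain ⟨e0, e1, e2, e3, e4⟩ := marginalDist₂_lvl2Law
  rw [log_two_mul_shannonEntropy_fin5, e0, e1, e2, e3, e4,
    negMulLog_div' (by norm_num) (by norm_num), negMulLog_div' (by norm_num) (by norm_num),
    negMulLog_div' (by norm_num) (by norm_num), negMulLog_div' (by norm_num) (by norm_num),
    negMulLog_div' (by norm_num) (by norm_num)]
  ring

/-- `ln 2 · H_z = ln 2 · H_y`. [folklore] -/
theorem entropy₃_lvl2Law : Real.log 2 * shannonEntropy (marginalDist₃ lvl2Law) =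
    Real.log 2054 - (79 * Real.log 79 + 650 * Real.log 650 + 1172 * Real.log 1172 +
      149 * Real.log 149 + 4 * Real.log 4) / 2054 := by
  obtain ⟨e0, e1, e2, e3, e4⟩ := marginalDist₃_lvl2Law
  rw [log_two_mul_shannonEntropy_fin5, e0, e1, e2, e3, e4,
    negMulLog_div' (by norm_num) (by norm_num), negMulLog_div' (by norm_num) (by norm_num),
    negMulLog_div' (by norm_num) (by norm_num), negMulLog_div' (by norm_num) (by norm_num),
    negMulLog_div' (by norm_num) (by norm_num)]
  ring

/-- Integer certificate: `∏ u_x^{u_x} ≤ ∏ u_y^{u_y}` (`H_y ≤ H_x`). [folklore] -/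
theorem cert_marginals :
    (1088 : ℕ) ^ 1088 * 640 ^ 640 * 316 ^ 316 * 10 ^ 10 ≤
      79 ^ 79 * 650 ^ 650 * 1172 ^ 1172 * 149 ^ 149 * 4 ^ 4 := by
  decide

/-- **`H_y ≤ H_x`**: the minimum marginal entropy of the law is `H_y` (`= H_z`). [folklore] -/
theorem entropy₂_le_entropy₁ :
    shannonEntropy (marginalDist₂ lvl2Law) ≤ shannonEntropy (marginalDist₁ lvl2Law) := by
  have hlog : 0 < Real.log 2 := Real.log_pos one_lt_two
  have h : ((1088 : ℕ) ^ 1088 * 640 ^ 640 * 316 ^ 316 * 10 ^ 10 : ℝ) ≤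
      (79 : ℕ) ^ 79 * 650 ^ 650 * 1172 ^ 1172 * 149 ^ 149 * 4 ^ 4 := by
    exact_mod_cast cert_marginals
  push_cast at h
  have h' := Real.log_le_log (by positivity) h
  rw [Real.log_mul (by positivity) (by positivity), Real.log_mul (by positivity) (by positivity),
    Real.log_mul (by positivity) (by positivity), Real.log_mul (by positivity) (by positivity),
    Real.log_mul (by positivity) (by positivity), Real.log_mul (by positivity) (by positivity),
    Real.log_mul (by positivity) (by positivity)] at h'
  simp only [Real.log_pow, Nat.cast_ofNat] at h'
  have e1 := entropy₁_lvl2Law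
  have e2 := entropy₂_lvl2Law
  have key : Real.log 2 * shannonEntropy (marginalDist₂ lvl2Law) ≤
      Real.log 2 * shannonEntropy (marginalDist₁ lvl2Law) := by
    rw [e1, e2]
    linarith [h']
  exact le_of_mul_le_mul_left key hlog

/-- `H_z = H_y`. [folklore] -/
theorem entropy₃_eq_entropy₂ :
    shannonEntropy (marginalDist₃ lvl2Law) = shannonEntropy (marginalDist₂ lvl2Law) := by
  have hlog : Real.log 2 ≠ 0 := (Real.log_pos one_lt_two).ne'
  have e := entropy₃_lvl2Law
  rw [← entropy₂_lvl2Law] at e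
  exact mul_left_cancel₀ hlog e

/-- **The minimum marginal entropy of the law is `H_y`.** [folklore] -/
theorem min_entropy_lvl2Law :
    min (shannonEntropy (marginalDist₁ lvl2Law)) (min (shannonEntropy (marginalDist₂ lvl2Law))
      (shannonEntropy (marginalDist₃ lvl2Law))) = shannonEntropy (marginalDist₂ lvl2Law) := by
  rw [entropy₃_eq_entropy₂, min_self]
  exact min_eq_right entropy₂_le_entropy₁

/-! ## The certificates and the conclusion -/

/-- Integer certificate: `6^14586 ≤ 12^1940 · 38^5860` (`A⁴ ≤ B` for the per-position formats).
[folklore] -/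
theorem cert_format : (6 : ℕ) ^ 14586 ≤ 12 ^ 1940 * 38 ^ 5860 := by
  decide

/-- Integer certificate of the final inequality `43 (ln 64 − H_y ln 2 − ln W) ≤ 223 ln A`:
`2^409688 · 5^55900 · 149^6407 · 293^50396 ≤ 3^117967 · 13^60372 · 19^12488 · 79^84925`. [folklore] -/
theorem cert_final :
    (2 : ℕ) ^ 409688 * 5 ^ 55900 * 149 ^ 6407 * 293 ^ 50396 ≤
      3 ^ 117967 * 13 ^ 60372 * 19 ^ 12488 * 79 ^ 84925 := by
  decide

/-- **Level 2 of the saturation ladder at `ω(1,4,1)` (the `k = 4` instance of the hypothesis of the node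
`TailDescentTwo`): `ω(1,4,1) ≤ 223/43`** (Le Gall 2012 §6 at `q = 6` in the tree's format currency,
with the `3 : 3 : 2` family block at `σ = 19/20` and the explicit design `lvl2Word`).
[cite: LeGall2012, §6.1, Prop. 6.2 and Table 2] [cite: CoppersmithWinograd1990, §8]
[cite: Coppersmith1997, §3] -/
theorem omegaRect_one_four_one_le_223_43 : omegaRect ℂ 1 4 1 ≤ 223 / 43 := by
  -- per-position value and formats: the `2054`-th roots of the totals
  set W : ℝ := Vtot ^ (((2054 : ℕ) : ℝ)⁻¹) with hWdef
  set A : ℝ := Xtot ^ (((2054 : ℕ) : ℝ)⁻¹) with hAdef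
  set B : ℝ := Ytot ^ (((2054 : ℕ) : ℝ)⁻¹) with hBdef
  have hW0 : 0 < W := Real.rpow_pos_of_pos Vtot_pos _
  have hA0 : 0 < A := Real.rpow_pos_of_pos Xtot_pos _
  have hB0 : 0 < B := Real.rpow_pos_of_pos Ytot_pos _
  have hWd : W ^ 2054 = Vtot := Real.rpow_inv_natCast_pow Vtot_pos.le (by norm_num)
  have hAd : A ^ 2054 = Xtot := Real.rpow_inv_natCast_pow Xtot_pos.le (by norm_num)
  have hBd : B ^ 2054 = Ytot := Real.rpow_inv_natCast_pow Ytot_pos.le (by norm_num)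
  have hblk : HasFormatValue (blockOf lvl2Word) (W ^ 2054) (A ^ 2054) (B ^ 2054) (A ^ 2054) := by
    rw [hWd, hAd, hBd]; exact hasFormatValue_lvl2Word
  -- the laser method on the valued word
  have hT := laserMethod_hasFormatValue_of_wordValue (bigCwSq ℂ 6) cwLev2 cwLev2 cwLev2
    cwSupport₂ (bigCwSq_cwSupport₂ ℂ 6) cwTight₂ cwTight₂ cwTight₂γ cwTight₂_injective
    cwTight₂_injective cwTight₂γ_injective cwTight₂_bound cwTight₂_bound cwTight₂_sum
    (by norm_num : 0 < 2054) lvl2Word lvl2Word_mem lvl2Law lvl2Law_eq hW0 hA0.le hB0.le hA0.le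
    hblk
  rw [maxEntropyPenalty_lvl2Law, sub_zero, min_entropy_lvl2Law] at hT
  -- logarithms of the roots
  have hlogW : Real.log W = (2054 : ℝ)⁻¹ * (102 * (6 * Real.log 2)) := by
    rw [hWdef, Real.log_rpow Vtot_pos, Vtot, one_mul, Real.log_pow,
      Real.log_rpow (by norm_num : (0 : ℝ) < 2)]
    push_cast; ring
  have hlogA : Real.log A = (2054 : ℝ)⁻¹ *
      (19 * Real.log 12 + 56 * Real.log 38 + 102 * (5 * Real.log 6)) := by
    rw [hAdef, Real.log_rpow Xtot_pos, Xtot, Real.log_mul (by positivity) (by positivity),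
      Real.log_mul (by positivity) (by positivity), Real.log_pow, Real.log_pow, Real.log_pow,
      Real.log_rpow (by norm_num : (0 : ℝ) < 6)]
    push_cast; ring
  have hlogB : Real.log B = (2054 : ℝ)⁻¹ *
      (270 * Real.log 12 + 810 * Real.log 38 + 102 * (57 / 10 * Real.log 6)) := by
    rw [hBdef, Real.log_rpow Ytot_pos, Ytot, Real.log_mul (by positivity) (by positivity),
      Real.log_mul (by positivity) (by positivity), Real.log_pow, Real.log_pow, Real.log_pow,
      Real.log_rpow (by norm_num : (0 : ℝ) < 6)]
    push_cast; ring
  have l12 : Real.log 12 = 2 * Real.log 2 + Real.log 3 := by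
    rw [show (12 : ℝ) = 2 ^ 2 * 3 by norm_num, Real.log_mul (by norm_num) (by norm_num),
      Real.log_pow]; push_cast; ring
  have l38 : Real.log 38 = Real.log 2 + Real.log 19 := by
    rw [show (38 : ℝ) = 2 * 19 by norm_num, Real.log_mul (by norm_num) (by norm_num)]
  have l6 : Real.log 6 = Real.log 2 + Real.log 3 := by
    rw [show (6 : ℝ) = 2 * 3 by norm_num, Real.log_mul (by norm_num) (by norm_num)]
  have l64 : Real.log 64 = 6 * Real.log 2 := by
    rw [show (64 : ℝ) = 2 ^ 6 by norm_num, Real.log_pow]; push_cast; ring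
  have l2054 : Real.log 2054 = Real.log 2 + Real.log 13 + Real.log 79 := by
    rw [show (2054 : ℝ) = 2 * 13 * 79 by norm_num, Real.log_mul (by norm_num) (by norm_num),
      Real.log_mul (by norm_num) (by norm_num)]
  have l650 : Real.log 650 = Real.log 2 + 2 * Real.log 5 + Real.log 13 := by
    rw [show (650 : ℝ) = 2 * 5 ^ 2 * 13 by norm_num, Real.log_mul (by norm_num) (by norm_num),
      Real.log_mul (by norm_num) (by norm_num), Real.log_pow]; push_cast; ring
  have l1172 : Real.log 1172 = 2 * Real.log 2 + Real.log 293 := by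
    rw [show (1172 : ℝ) = 2 ^ 2 * 293 by norm_num, Real.log_mul (by norm_num) (by norm_num),
      Real.log_pow]; push_cast; ring
  have l4 : Real.log 4 = 2 * Real.log 2 := by
    rw [show (4 : ℝ) = 2 ^ 2 by norm_num, Real.log_pow]; push_cast; ring
  -- (1) `A > 1`
  have hX1 : 1 < Xtot := by
    unfold Xtot
    have h1 : (1 : ℝ) < 12 ^ 19 * 38 ^ 56 := by norm_num
    have h2 : (1 : ℝ) ≤ ((6 : ℝ) ^ (5 : ℝ)) ^ 102 :=
      one_le_pow₀ (Real.one_le_rpow (by norm_num) (by norm_num))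
    exact one_lt_mul_of_lt_of_le h1 h2
  have hA1 : 1 < A := Real.one_lt_rpow hX1 (by positivity)
  have hlA : 0 < Real.log A := Real.log_pos hA1
  -- (2) the format inequality `A⁴ ≤ B`
  have hAB : A ^ (4 : ℝ) ≤ B := by
    rw [← Real.log_le_log_iff (Real.rpow_pos_of_pos hA0 _) hB0, Real.log_rpow hA0, hlogA, hlogB]
    have hc : ((6 : ℕ) ^ 14586 : ℝ) ≤ (12 : ℕ) ^ 1940 * (38 : ℕ) ^ 5860 := by
      exact_mod_cast cert_format
    push_cast at hc
    have hc' := Real.log_le_log (by positivity) hc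
    rw [Real.log_mul (by positivity) (by positivity)] at hc'
    simp only [Real.log_pow, Nat.cast_ofNat] at hc'
    linarith
  -- (3) the packing bound `2^{H_y} W A^{ω(1,4,1)} ≤ R̃(CW_6^{⊗2}) ≤ 64`, in logarithms
  have hmain := mul_rpow_omegaRect_le_asymptoticRank_of_hasFormatValue hT hA1 (by norm_num) hAB
  have h64 := hmain.trans asymptoticRank_bigCwSq_six_le
  have hpos : 0 < (2 : ℝ) ^ shannonEntropy (marginalDist₂ lvl2Law) * W * A ^ omegaRect ℂ 1 4 1 := by
    positivity
  have hlog := Real.log_le_log hpos h64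
  rw [Real.log_mul (by positivity) (by positivity), Real.log_mul (by positivity) (by positivity),
    Real.log_rpow (by norm_num : (0 : ℝ) < 2), Real.log_rpow hA0] at hlog
  -- (4) the final certificate: `ln 64 − H_y ln 2 − ln W ≤ (223/43) ln A`
  have e2 := entropy₂_lvl2Law
  rw [l2054, l650, l1172, l4] at e2
  have hc : ((2 : ℕ) ^ 409688 * (5 : ℕ) ^ 55900 * (149 : ℕ) ^ 6407 * (293 : ℕ) ^ 50396 : ℝ) ≤
      (3 : ℕ) ^ 117967 * (13 : ℕ) ^ 60372 * (19 : ℕ) ^ 12488 * (79 : ℕ) ^ 84925 := by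
    exact_mod_cast cert_final
  push_cast at hc
  have hc' := Real.log_le_log (by positivity) hc
  rw [Real.log_mul (by positivity) (by positivity), Real.log_mul (by positivity) (by positivity),
    Real.log_mul (by positivity) (by positivity), Real.log_mul (by positivity) (by positivity),
    Real.log_mul (by positivity) (by positivity), Real.log_mul (by positivity) (by positivity)] at hc'
  simp only [Real.log_pow, Nat.cast_ofNat] at hc'
  have hfin : Real.log 64 - shannonEntropy (marginalDist₂ lvl2Law) * Real.log 2 - Real.log W ≤
      223 / 43 * Real.log A := by
    rw [hlogW, hlogA, l64, l12, l38, l6]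
    linarith
  have key : omegaRect ℂ 1 4 1 * Real.log A ≤ 223 / 43 * Real.log A := by linarith
  exact le_of_mul_le_mul_right key hlA

/-- **`ω(1,4,1) < 5.1861`.** [cite: LeGall2012, Table 2] -/
theorem omegaRect_one_four_one_lt_5_1861 : omegaRect ℂ 1 4 1 < 5.1861 :=
  lt_of_le_of_lt omegaRect_one_four_one_le_223_43 (by norm_num)

/-- **The `k = 4` rung beats descent from the `k = 3` rung** (`80/19 + 1 = 99/19 = 5.2105…`,
`SaturationLadderLevelTwoK3.omegaRect_one_mid_one_le_add_of_three`). [cite: LeGall2012, Table 2] -/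
theorem omegaRect_one_four_one_lt_descent : omegaRect ℂ 1 4 1 < 99 / 19 :=
  lt_of_le_of_lt omegaRect_one_four_one_le_223_43 (by norm_num)

/-- The remaining gap of the rung to `ω(1,4,1) = 5` (the `k = 4` instance of the hypothesis of
`TailDescentTwo`) is `< 0.1861`: the level-2 defect ladder reads `0.2581 (k=2) > 0.2106 (k=3) >
0.1861 (k=4)`. [cite: LeGall2012, Table 2] -/
theorem omegaRect_one_four_one_sub_five_lt : omegaRect ℂ 1 4 1 - 5 < 0.1861 := by
  have := omegaRect_one_four_one_le_223_43; norm_num at this ⊢; linarith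

/-- **Descent to the tail**: `ω(1,k,1) ≤ k + 51/43` for every real `k ≥ 4`
(`omegaRect_one_mid_one_le_add`). [cite: Coppersmith1997, §3] -/
theorem omegaRect_one_mid_one_le_add_of_four (k : ℝ) (hk : 4 ≤ k) :
    omegaRect ℂ 1 k 1 ≤ k + 51 / 43 := by
  have h := omegaRect_one_mid_one_le_add (K := ℂ) hk
  have h4 := omegaRect_one_four_one_le_223_43
  norm_num at h h4 ⊢
  linarith

end Summit.MatrixMultiplication.MatrixMultiplication.Theorems.SaturationLadderLevelTwoK4

end
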